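import Summits.SmoothPoincare4.SmoothPoincare4.Theses.SchoenfliesSplit
import Summits.SmoothPoincare4.SmoothPoincare4.Theses.SymplecticOrigami
import Summits.SmoothPoincare4.SmoothPoincare4.Theses.EuclideanOrigami
import Summits.SmoothPoincare4.SmoothPoincare4.Theorems.SchsplitCerf.Negative.RefutationCost
import Literature.Topology.FourManifolds.CerfGammaFourProofs
import Literature.Topology.FourManifolds.BallGluingUniqueness
import Literature.Topology.FourManifolds.RadialExtension
import Literature.Topology.FourManifolds.CerfTheoremOne
import Literature.Topology.FourManifolds.SmoothOrientationSphereProofs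
import Literature.Topology.FourManifolds.SmoothOrientationDiffeomorphProofs
import Literature.Geometry.Symplectic.StandardEnd
import Literature.Geometry.Symplectic.SteinBall
import HarnessLib

/-!
# Line `eliashberg-levi-flat-discs` — skeleton for crux `SchsplitCerf` (Cerf's `Γ₄ = 0`)

Crux (FIXED, never restated): item stmt-SmoothPoincare4-8758 =
`Summit.SmoothPoincare4.SmoothPoincare4.Theses.SchoenfliesSplit.SchsplitCerf`
(= `SymplecticOrigami.CerfGammaFour` = `EuclideanOrigami.SchsplitCerf`, all VERBATIM the tree's
named fact `Literature.Topology.FourManifolds.cerf_twistedSphere_four`): every twisted 4-sphere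
`D⁴ ∪_φ D⁴` is diffeomorphic to `S⁴`.  A THEOREM (Cerf 1968); lines compete on formal cost and on
which printed proof they follow.  Idea card `Cruxes/SchsplitCerf/Ideas/eliashberg-levi-flat-discs.md`
(crux-ideate r1 k1; triage r1-1/2/3: pass ×3, merged with `levi-flat-disc-fibration`); planner
`planner-cruxplan-stmt-SmoothPoincare4-8758-eliashberg-levi-flat-0`, 2026-08-16.

## The line: ELIASHBERG'S PROOF OF CERF'S THEOREM, in the architecture of Geiges–Zehmisch 2010

The idea card followed the SKETCH in Geiges 2008 §4.11 (Prop. 4.11.2, pp. 254–256: level spheres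
`S^t = {y₂ = t}`, Bishop/Bedford–Gaveau discs in the honest ball `(D⁴, i)`, leafwise isotopy,
2-parameter `Γ₂`/Smale extension).  All three triagers asked to anchor the engine to the COMPLETE
printed proof, Geiges–Zehmisch, *Eliashberg's proof of Cerf's theorem*, J. Topol. Anal. 2 (2010)
543–579 = arXiv:1007.3606 [GeigesZehmisch2010] (read in full for this skeleton).  GZ10 carry out
Eliashberg's programme with a MODULI SPACE of holomorphic discs with three marked boundary points;
two consequences reshape the card's stub list:

* the normalisation is "`φ` = id on a neighbourhood of the whole unknot
  `K = {z₁ = 0} ∩ S³`" (GZ10 Prop. 3.1: contact disc theorem applied to ONE contact ball containing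
  `K`), not only near the two poles — this is what makes the adapted filling COINCIDE with the
  standard one near the singular set `K`, so smoothness of the extension at `K` is free;
* "`Γ₂ = 0` is not mentioned": marked points fix the disc parametrisations, and the residual
  boundary correction `χ = f_st⁻¹ ∘ φ⁻¹ ∘ f` is LEVEL-PRESERVING with `∂_θ χ¹ > 0` (maximum
  principle), so it is isotopic to the identity by two explicit straight-line isotopies
  (GZ10 Lemma 5.3).  No Smale theorem at any `πₖ` — the triage-1 worry "Y4 needs π₁-Smale for
  `Diff₀(S²)`" disappears.

Registered stubs (4; sizes XL / M–L / XL / L; none is bookkeeping):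

* `stub_contactRepresentative` — **K1** (GZ10 Prop 3.1 ¶1 = Geiges 2008 Lemma 4.11.1 =
  Eliashberg 1992 Thm 2.1.1: uniqueness of the tight `S³` + Gray stability; coorientation fixed by
  complex conjugation `∈ SO(4)`): every orientation-preserving `f ∈ Diff(S³)` is diffeotopic to a
  POSITIVE contactomorphism of `α₀ = ½(x₁dy₁ - y₁dx₁ + x₂dy₂ - y₂dx₂)`.  XL named-fact shape; typing
  (`IsStdContacto`) verbatim that of line A (`contact-isotopy-gromov-cone`, SketchIdeator1), so the
  two lines share it.
* `stub_fixUnknotNbhd` — **FIX-K** (GZ10 Prop 3.1 ¶2–3; Geiges 2008 Thm 2.6.7 contact disc theorem,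
  Cor 2.6.3): a positive contactomorphism is diffeotopic (by a contact isotopy) to a positive
  contactomorphism equal to the identity on a standard neighbourhood `𝒰^ε = {|z₁|² < ε}` of `K`.
  M–L.
* `stub_bishopFilling` — **ENGINE, hardest** (GZ10 §4 Props 4.1–4.7, Props 5.1, 5.2, Prop 6.1
  compactness, Prop 7.1/7.5 automatic transversality, Thm 9.2 positivity of intersections, Thm 9.4
  relative adjunction; = Eliashberg 1990 filling by holomorphic discs [Eliashberg1990],
  Bedford–Gaveau 1983, Gromov 1985 2.4.D [Gromov1985], in the honest `(D⁴, J₀)`): for a positive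
  contactomorphism `ψ` equal to id on `𝒰^ε` there is a diffeomorphism `Γ` of the closed 4-ball which
  (a) restricts on `S³` to some `g`, (b) maps EVERY standard flat disc `D^t_s = D⁴ ∩ (ℂ × {s+it})`
  to a `J₀`-HOLOMORPHIC disc (it is `G = F ∘ F_st⁻¹ ∪ id` for the holomorphic filling `F` adapted
  to `ψ`, GZ10 §5), and (c) whose boundary correction `m := ψ⁻¹ ∘ g` preserves every level sphere
  `S^t`, is the identity on some `𝒰^{ε'}`, and maps the standard circles `𝔠 = ∂D^t_s` (orbits of
  `θ ↦ (e^{iθ}z₁, z₂)`) to curves POSITIVELY TRANSVERSE to `ξ = ker α₀` (maximum principle, GZ10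
  Prop 4.2).  XL (the analysis: Banach-manifold set-up, elliptic regularity up to the totally real
  boundary, Hofer bubbling-off, linearised CR operator of index 5 — none of it in Mathlib).
  Clause (b) is the holomorphic CERTIFICATE of the lever: without it the stub would follow from K2
  by taking `g := ψ`, `m := id`; with it the stub says "a holomorphic filling of `S³` adapted to `ψ`
  exists and assembles to a diffeomorphism of `D⁴`".  (b) is not consumed by the composition, so a
  lead who prefers to VENDOR may drop it, or collapse FIX-K + ENGINE + LEVEL into the single named
  fact K2 = Geiges Prop 4.11.2 (`contactomorphismsExtend` below), without touching `SchsplitCerf_of`.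
* `stub_levelTransverse` — **LEVEL** (GZ10 Lemma 5.3, generalised from "marked point fixed" to
  "lift normalised on the connected collar"): a diffeomorphism `m` of `S³` that preserves `H = y₂`,
  is the identity on some `𝒰^ε`, and is positively transverse on the standard circles is
  DIFFEOTOPIC TO THE IDENTITY — in Legendrian–transverse coordinates `(θ'', s, t)` on
  `S³ ∖ 𝒰^ε` (`θ'' = θ - θ(s,t)`, GZ10 §2.3) it reads `χ = (χ¹, χ², t)` with `∂_θ χ¹ > 0`, and
  `(χ¹, (1-σ)χ² + σs, t)` then `((1-τ)χ¹ + τθ, s, t)` are isotopies stationary near the boundary.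
  L (coordinates degenerate only inside `𝒰^ε`, where `m = id`).

Composition (kernel-checked, no `sorry` of its own): `contactomorphismsExtend` (K2 for positive
contactomorphisms: FIX-K, ENGINE, LEVEL, then `ψ = m⁻¹ · g ∈ Ext` by Cerf's Lemma 2
`ExtendsOverBall.of_isDiffeotopicToId` and the group law, `φ ∈ Ext` by `.of_isDiffeotopic`) →
`cerf_extends` (K1 + orientation split: reflections extend linearly, `extendsOverBall_sphereReflection`;
verbatim the PROVED glue `cerf_extends_of_contact` of SketchIdeator1) →
`SchsplitCerf_of` / `CerfGammaFour_of` / `EuclideanOrigami_SchsplitCerf_of` via the tree's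
`cerf_twistedSphere_four_of_extends''`.  `#h21_check_skeleton`: ok, theorem `SchsplitCerf_of`,
sorries exactly the four `stub_*`.

Disproof.lean (cdisprove v1 + 03:22Z refresh, NO KILL) honoured: §2 `schsplitCerf_of_extends` is
this line's entry point (we prove `cerf_diffeomorph_sphere_three_extends_ball`); §3
`_false_without_gluing` / `_false_without_cover` are consumed by the tree chain
`cerf_twistedSphere_four_of_extends''` (gluing + cover never re-enter); §4(i)
`not_forall_isDiffeotopicToId_sphere_three` — honoured in `cerf_extends` (orientation split;
K1 is stated for orientation-PRESERVING `f` only; LEVEL concludes `IsDiffeotopicToId` only for an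
`m` that is the identity near `K`, hence orientation-preserving); §4(iii) (`Γ₇ = ℤ/28`: any proof
must use `n = 3`) — every stub is specific to `S³ ⊂ ℂ²` (tight `ξ_st`, strict pseudoconvexity,
Hopf circles); §1: no stub mentions a twisted sphere or `S⁴` (no costume).  Landed Negative lemma
imported (`Negative/RefutationCost`): it refutes nothing here (the crux is a theorem).
Negatives index (`ledger negatives --problem SmoothPoincare4`): 0 refuted statements.

Sanity (sorry-free, end of file): `isStdContacto_refl` (hypotheses of K1/FIX-K/ENGINE satisfiable),
`deriv_turnVec_zero` + `stdSymplecticForm_turnGen` + `levelClauses_refl` (the identity satisfies the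
three `m`-clauses: `ω₀(p, ∂_θ) = |z₁|² > 0` off `K` — sign conventions of `stdSymplecticForm` /
`hopfTurn` pinned), `isJHolAt_stdDisc` (the standard discs are `J₀`-holomorphic for
`stdComplexStructure` — convention of clause (b) pinned), and `engine_at_refl`: the WHOLE typed
conclusion of ENGINE is proved at `ψ = id` (`g = Γ = id`: the standard filling `F_st` = GZ10's
`𝒲_id`), so the stub is non-vacuous and its clauses are mutually consistent.
-/

noncomputable section

-- the prescribed namespace `Summit.<P>.<Sub>.…` duplicates `SmoothPoincare4` (P = Sub)
set_option linter.dupNamespace false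

open scoped Manifold ContDiff Topology
open Set Function Metric
open Literature.Topology.FourManifolds Literature.Geometry.Symplectic

namespace Summit.SmoothPoincare4.SmoothPoincare4.Cruxes.SchsplitCerf.EliashbergLeviFlatDiscs

/-- The unit 3-sphere `S³ ⊂ ℝ⁴ = ℂ²` (as in the crux decl). -/
local notation "𝕊³" => (Metric.sphere (0 : EuclideanSpace ℝ (Fin 4)) 1)
/-- The model `ℝ⁴ = ℂ²`, coordinates `(x₁, y₁, x₂, y₂)` = indices `0, 1, 2, 3`,
`z₁ = x₁ + i y₁`, `z₂ = x₂ + i y₂`; `J₀ = stdComplexStructure`, `ω₀ = stdSymplecticForm = dλ`,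
`α₀ = λ|S³ = ½ ω₀(p, ·)` (GZ10 §2.1). -/
local notation "E4" => EuclideanSpace ℝ (Fin 4)
/-- The closed unit 4-ball with its manifold-with-boundary structure (`ClosedBall.lean`,
model `𝓡∂ (3 + 1)`; written `Fin (3 + 1)` to match `ExtendsOverBall 3`). -/
local notation "𝔻⁴" => (Metric.closedBall (0 : EuclideanSpace ℝ (Fin (3 + 1))) 1)

/-! ## Vocabulary (flat and explicit; no new structures) -/

/-- `φ` is a POSITIVE contactomorphism of the standard contact form `α₀_z(v) = ½ ω₀(z, v)` of
`S³ ⊂ (ℝ⁴, ω₀)` with conformal factor `e^u`: `φ^* α₀ = e^u α₀`, `u` smooth (tangent vectors read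
in `ℝ⁴` through the differential of the inclusion).  VERBATIM the typing of line A
(`SketchIdeator1.IsStdContacto`), so that K1 is one shared stub. [cite: GeigesZehmisch2010, §2.1] -/
def IsStdContacto (φ : 𝕊³ ≃ₘ⟮𝓡 3, 𝓡 3⟯ 𝕊³) (u : 𝕊³ → ℝ) : Prop :=
  ContMDiff (𝓡 3) 𝓘(ℝ, ℝ) ∞ u ∧
    ∀ (z : 𝕊³) (v : TangentSpace (𝓡 3) z),
      stdSymplecticForm ((φ z : 𝕊³) : E4)
          (mfderiv (𝓡 3) 𝓘(ℝ, E4) (fun w : 𝕊³ => ((φ w : 𝕊³) : E4)) z v) =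
        Real.exp (u z) *
          stdSymplecticForm ((z : 𝕊³) : E4)
            (mfderiv (𝓡 3) 𝓘(ℝ, E4) (fun w : 𝕊³ => ((w : 𝕊³) : E4)) z v)

/-- The height `H = y₂` (coordinate `3`) on `S³`; its levels `S^t = H⁻¹(t)`, `t ∈ (-1, 1)`, are
the round 2-spheres of Eliashberg's family, each with exactly two (elliptic) complex points
`q^t_± = (0, 0, ±√(1-t²), t)` (GZ10 §2; Geiges 2008 p. 256). -/
def height (p : 𝕊³) : ℝ := (p : E4) 3

/-- `|z₁|² = x₁² + y₁²`.  `K = {zOneSq = 0} ∩ S³ = {(0, 0, ±√(1-t²), t)}` is the transverse UNKNOT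
of complex points of the family (plus the two poles of `H`), and `{zOneSq < δ}` is EXACTLY the
standard neighbourhood `𝒰^δ = F_st(S¹ × {1 - δ < s² + t² ≤ 1})` of GZ10 §2.6
(`|z₁|² = 1 - s² - t²` on `S³`). -/
def zOneSq (p : 𝕊³) : ℝ := (p : E4) 0 ^ 2 + (p : E4) 1 ^ 2

/-- Rotation of the `z₁`-coordinate by the angle `θ`, `(z₁, z₂) ↦ (e^{iθ} z₁, z₂)`, on vectors. -/
def turnVec (θ : ℝ) (x : E4) : E4 :=
  WithLp.toLp 2
    ![Real.cos θ * x 0 - Real.sin θ * x 1, Real.sin θ * x 0 + Real.cos θ * x 1, x 2, x 3]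

@[simp] theorem turnVec_apply_zero (θ : ℝ) (x : E4) :
    turnVec θ x 0 = Real.cos θ * x 0 - Real.sin θ * x 1 := rfl
@[simp] theorem turnVec_apply_one (θ : ℝ) (x : E4) :
    turnVec θ x 1 = Real.sin θ * x 0 + Real.cos θ * x 1 := rfl
@[simp] theorem turnVec_apply_two (θ : ℝ) (x : E4) : turnVec θ x 2 = x 2 := rfl
@[simp] theorem turnVec_apply_three (θ : ℝ) (x : E4) : turnVec θ x 3 = x 3 := rfl

/-- The rotation preserves the norm. -/
theorem norm_turnVec (θ : ℝ) (x : E4) : ‖turnVec θ x‖ = ‖x‖ := by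
  have h : ‖turnVec θ x‖ ^ 2 = ‖x‖ ^ 2 := by
    rw [EuclideanSpace.real_norm_sq_eq, EuclideanSpace.real_norm_sq_eq, Fin.sum_univ_four,
      Fin.sum_univ_four, turnVec_apply_zero, turnVec_apply_one, turnVec_apply_two,
      turnVec_apply_three]
    linear_combination (x 0 ^ 2 + x 1 ^ 2) * Real.cos_sq_add_sin_sq θ
  calc ‖turnVec θ x‖ = Real.sqrt (‖turnVec θ x‖ ^ 2) := (Real.sqrt_sq (norm_nonneg _)).symm
    _ = Real.sqrt (‖x‖ ^ 2) := by rw [h]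
    _ = ‖x‖ := Real.sqrt_sq (norm_nonneg _)

/-- The standard circle action on `S³`, `θ ↦ (e^{iθ} z₁, z₂)`; its orbits through `S³ ∖ K` are the
standard circles `𝔠 = ∂D^t_s` bounding the flat holomorphic discs (GZ10 §2), positively transverse
to `ξ`: `α₀(∂_θ) = ½|z₁|²` (GZ10 §2.4). -/
def hopfTurn (θ : ℝ) (p : 𝕊³) : 𝕊³ :=
  ⟨turnVec θ p, by rw [mem_sphere_zero_iff_norm, norm_turnVec, norm_eq_of_mem_sphere p]⟩

@[simp] theorem coe_hopfTurn (θ : ℝ) (p : 𝕊³) : ((hopfTurn θ p : 𝕊³) : E4) = turnVec θ p := rfl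

/-- The standard flat holomorphic disc `D^t_s = D⁴ ∩ (ℂ × {x₂ = s, y₂ = t})`, parametrised by
`z ↦ (√(1 - s² - t²) z, s + it)` (GZ10 §2.3 without the unit rotation factor `e^{iθ(s,t)}`, which
changes neither the disc nor holomorphicity).  For `s² + t² < 1` and `|z| ≤ 1` it lies in `D⁴`,
its boundary circle is `𝔠 ⊂ S^t`. -/
def stdDisc (s t : ℝ) (z : ℂ) : E4 :=
  WithLp.toLp 2
    ![Real.sqrt (1 - s ^ 2 - t ^ 2) * z.re, Real.sqrt (1 - s ^ 2 - t ^ 2) * z.im, s, t]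

/-- The image of the standard disc `D^t_s` under a self-map `Γ` of the closed 4-ball, as a map
`ℂ → ℝ⁴`; the point is clamped into `𝔻⁴` by the radial retraction of `ClosedBall.lean`, which is
the identity on `𝔻⁴` (`closedBallRetraction_of_norm_le`), so no membership proof enters the
statement. -/
def discImage (Γ : 𝔻⁴ → 𝔻⁴) (s t : ℝ) (z : ℂ) : E4 :=
  ((Γ (closedBallRetraction (3 + 1) (stdDisc s t z)) : 𝔻⁴) : E4)

/-- `f : ℂ → ℝ⁴ = ℂ²` is `J₀`-holomorphic at `z`: it is (really) differentiable there and its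
Fréchet derivative is complex linear, `Df(z)(iw) = J₀ Df(z)(w)` (Cauchy–Riemann; GZ10 §4
`∂̄u = 0`; differentiability is demanded so that the junk value `fderiv = 0` cannot satisfy it). -/
def IsJHolAt (f : ℂ → E4) (z : ℂ) : Prop :=
  DifferentiableAt ℝ f z ∧
    ∀ w : ℂ, fderiv ℝ f z (Complex.I * w) = stdComplexStructure (fderiv ℝ f z w)

/-! ## Registered stubs (`theorem stub_… := by sorry`; the ONLY sorries of the file) -/

/-- **Stub K1 — `ContactRepresentative` (XL, named-fact shape; shared with line A).**
Every orientation-preserving self-diffeomorphism `f` of `S³` is diffeotopic to a POSITIVE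
contactomorphism `g` of the standard contact form, `g^*α₀ = e^u α₀`.
Printed proof: `Tf(ξ_st)` is a positive tight contact structure on `S³`, isotopic to `ξ_st` by
Eliashberg's uniqueness theorem (Geiges 2008 Thm 4.10.1(a)/4.10.3 = Eliashberg 1992 Thm 2.1.1,
proved by convex-surface "tomography" Thm 4.9.4 — NO diffeomorphism-group input, so not Cerf in
costume; tightness of `ξ_st` by Bennequin or by fillability Cor 6.5.10); Gray stability (Thm 2.2.2)
turns the isotopy of plane fields into `ψ_t` with `g := ψ₁ ∘ f` a contactomorphism (Lemma 4.11.1,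
p. 254; GZ10 Prop 3.1 ¶1); if `g` reverses the coorientation (`g^*α₀ = -e^u α₀`), compose with
complex conjugation `(z₁, z₂) ↦ (z̄₁, z̄₂) ∈ SO(4)`, which preserves `ξ_st`, reverses `α₀`, and is
diffeotopic to `id` inside the connected group `SO(4)`.  Why plausibly true: it is a theorem in
print (three independent expositions).  Size XL (formal debt: tight/overtwisted dichotomy, convex
surfaces, Gray).  [cite: Geiges2008, Lemma 4.11.1; Eliashberg1992, Thm 2.1.1; GeigesZehmisch2010, Prop 3.1] -/
theorem stub_contactRepresentative :
    ∀ (o : SmoothOrientation (𝓡 3) 𝕊³) (f : 𝕊³ ≃ₘ⟮𝓡 3, 𝓡 3⟯ 𝕊³),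
      f.IsOrientationPreserving o o →
        ∃ (g : 𝕊³ ≃ₘ⟮𝓡 3, 𝓡 3⟯ 𝕊³) (u : 𝕊³ → ℝ),
          Diffeomorph.IsDiffeotopic g f ∧ IsStdContacto g u := by
  sorry

/-- **Stub FIX-K — the contactomorphism may be taken to be the identity near the unknot `K`
(M–L; GZ10 Prop 3.1 ¶2–3).**  For every positive contactomorphism `φ` there are a positive
contactomorphism `ψ`, DIFFEOTOPIC to `φ`, and `ε > 0` with `ψ = id` on `𝒰^ε = {|z₁|² < ε}`.
Printed proof: the contactomorphism `(ℝ³, ker(dw + u dv - v du)) → (S³ ∖ pt, ξ)` of Geiges 2008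
Prop 2.1.8 (composed with `(z₁, z₂) ↦ (z₂, z₁)`) sends the unit circle `C` of the `uv`-plane to `K`; restrict it
to a contact embedding `j` of the ball `B` of radius 2; `φ ∘ j` is a second cooriented contact
embedding of `B`; the CONTACT DISC THEOREM (Geiges 2008 Thm 2.6.7, with Cor 2.6.3) gives a compactly
supported contact isotopy `ψ_t` with `ψ₁ ∘ φ ∘ j = j`; put `ψ := ψ₁ ∘ φ` (positive: composition of
positive contactomorphisms; diffeotopic to `φ` along `t ↦ ψ_t ∘ φ`, a smooth path made stationary
near its ends); `ψ = id` on the open set `j(int B) ⊇ K`, which contains `{|z₁|² < ε}` for small `ε`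
by compactness (`{|z₁|² ≤ ε}` shrink to `K = {z₁ = 0} ∩ S³`).  Why it might fail: only through the
typing — `Diffeomorph.IsDiffeotopic` wants a `Diffeotopy` (smooth track on `ℝ × S³`), which a
reparametrised contact isotopy is.  [cite: GeigesZehmisch2010, Prop 3.1; Geiges2008, Thm 2.6.7 and Prop 2.1.8] -/
theorem stub_fixUnknotNbhd :
    ∀ (φ : 𝕊³ ≃ₘ⟮𝓡 3, 𝓡 3⟯ 𝕊³) (u : 𝕊³ → ℝ), IsStdContacto φ u →
      ∃ (ψ : 𝕊³ ≃ₘ⟮𝓡 3, 𝓡 3⟯ 𝕊³) (u' : 𝕊³ → ℝ) (ε : ℝ),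
        IsStdContacto ψ u' ∧ Diffeomorph.IsDiffeotopic ψ φ ∧ 0 < ε ∧
          ∀ p : 𝕊³, zOneSq p < ε → ψ p = p := by
  sorry

/-- **Stub ENGINE — `BishopFilling`: Eliashberg's filling by holomorphic discs, adapted to `ψ`,
assembled to a diffeomorphism of `D⁴` (XL, the HARDEST stub, load-bearing; GZ10 §§4–9).**
Let `ψ` be a positive contactomorphism equal to the identity on `𝒰^ε`.  Then there are a
diffeomorphism `Γ` of the closed 4-ball (manifold with boundary), its boundary value `g`, and
`ε' > 0` such that
(a) `Γ ∘ ι = ι ∘ g` on `S³` (so `g ∈ Ext` by definition: `ExtendsOverBall 3 g`);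
(b) HOLOMORPHIC CERTIFICATE: for every `(s, t)` with `s² + t² < 1`, the disc
    `z ↦ Γ(D^t_s(z))` is `J₀`-holomorphic on the open unit disc — `Γ` carries the standard
    holomorphic filling `F_st` of `D⁴ ∖ K` to a holomorphic filling adapted to `ψ`;
(c) the boundary correction `m := ψ⁻¹ ∘ g = g.trans ψ.symm` preserves every level `S^t` of the
    height, is the identity on `𝒰^{ε'}`, and maps the standard circles `θ ↦ (e^{iθ}z₁, z₂)` to curves
    POSITIVELY TRANSVERSE to `ξ = ker α₀`: `ω₀(m p, d/dθ|₀ m(e^{iθ}·p)) = 2 α₀(Dm ∂_θ) > 0` off `K`.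
Printed proof (GZ10, verbatim architecture): `t`-level Bishop discs for `ψ` = holomorphic
`u : (𝔻, ∂𝔻) → (D⁴, ψ(S^t) ∖ {q^t_±})` in the class `A^t` with three marked points on three
characteristic leaves (§4); Maslov index 2 (Prop 4.1); maximum principle — interior in `Int D⁴`,
boundary an immersion positively transverse to the characteristic foliation (Prop 4.2); simple,
embedded, pairwise disjoint (Props 4.3, 4.5 via positivity of intersections Thm 9.2 and the relative
adjunction inequality Thm 9.4); a Bishop disc meeting `𝒰̄^δ` is standard (Cor 4.6, uses `ψ = id` on
`𝒰 ⊇ 𝒰̄^δ`); uniform energy bound (Prop 4.7); the truncated moduli space `𝒲^δ_ψ` is COMPACT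
(Prop 6.1: Hofer's lemma, bubbling-off analysis on `ℍ`, no bubbles by the energy/transversality
bookkeeping) and a 2-MANIFOLD with boundary `{u^t_s : s² + t² = 1 - δ}` (Prop 7.1: the linearised
CR operator `D_u` is onto with 5-dimensional kernel, Prop 7.5 — automatic transversality à la
Gromov / Hofer–Lizan–Sikorav); hence `ev₁ : 𝒲^δ_ψ → ψ(Q^δ)` is a diffeomorphism (Prop 5.1),
`F^δ(z, s, t) := (ev₁⁻¹(ψ(u^t_s(1))))(z)` is an embedding of the bidisc (Prop 5.2) equal to `F_st`
near its rim, `F := F^δ ∪ F_st` is a holomorphic filling adapted to `ψ` (Def. §5), and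
`G := F ∘ F_st⁻¹` on `D⁴ ∖ 𝒱^δ`, `id` on `𝒱^δ = {|z₂|² > 1 - δ}` "is a diffeomorphism of `D⁴`"
(proof of `Γ₄ = 0`, §5).  Take `Γ := G` (after `z ↦ e^{-iθ(s,t)} z`, our `stdDisc` is GZ10's
`u^t_s`, so `Γ ∘ D^t_s(z) = F(e^{-iθ(s,t)}z, s, t)` is a Bishop disc, resp. a standard disc on
`𝒱^δ`: (b) holds for ALL `s² + t² < 1`); `g := G|S³ = f ∘ f_st⁻¹ ∪ id`; `ε' := δ < ε`.  Then (c):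
`m = ψ⁻¹ ∘ g` maps `S^t` into `ψ⁻¹(ψ(S^t)) = S^t` (boundaries of `t`-level discs lie in
`S̃^t = ψ(S^t)`), is `id` on `𝒰^δ` (there `g = id` and `ψ = id`), and `g` maps the standard circle
through `p ∉ 𝒰^δ` onto the boundary of a holomorphic disc traversed positively, which is positively
transverse to `ξ` (Prop 4.2), a property `ψ⁻¹` (a positive contactomorphism) preserves; on
`𝒰^δ ∖ K`, `m = id` locally and `ω₀(p, ∂_θ) = |z₁|² > 0` (`stdSymplecticForm_turnGen`).
Why it might fail: not mathematically (refereed, complete); FORMALLY it is the whole of GZ10 §§4–9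
with McDuff–Salamon 2004 App. B/C behind it (Banach manifolds `W^{1,p}`, elliptic regularity at a
totally real boundary, Riemann–Roch for the disc, Carleman similarity, positivity of
intersections) — XL, no Mathlib support; and `Γ` must be packaged as a `Diffeomorph` for `𝓡∂ 4`
(smooth up to the boundary ⇒ `ContMDiff` via Seeley extension, `ClosedBallExtension.lean`).
Relation to K2: (a) ∧ (c) alone would follow from K2 with `g := ψ`, `m := id`; clause (b) is what
makes this stub the LEVER of the line and not a renaming of K2; conversely ENGINE ∧ LEVEL ⇒ K2
(`contactomorphismsExtend`).  [cite: GeigesZehmisch2010, Props 4.2, 5.1, 5.2, 6.1, 7.1, Lemma 5.3 set-up; Eliashberg1990; Gromov1985, 2.4.D] -/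
theorem stub_bishopFilling :
    ∀ (ψ : 𝕊³ ≃ₘ⟮𝓡 3, 𝓡 3⟯ 𝕊³) (u : 𝕊³ → ℝ) (ε : ℝ), IsStdContacto ψ u → 0 < ε →
      (∀ p : 𝕊³, zOneSq p < ε → ψ p = p) →
        ∃ (g : 𝕊³ ≃ₘ⟮𝓡 3, 𝓡 3⟯ 𝕊³) (Γ : 𝔻⁴ ≃ₘ⟮𝓡∂ (3 + 1), 𝓡∂ (3 + 1)⟯ 𝔻⁴) (ε' : ℝ),
          (∀ z : 𝕊³, Γ (Set.inclusion Metric.sphere_subset_closedBall z) =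
              Set.inclusion Metric.sphere_subset_closedBall (g z)) ∧
          (∀ s t : ℝ, s ^ 2 + t ^ 2 < 1 → ∀ z ∈ Metric.ball (0 : ℂ) 1,
              IsJHolAt (discImage Γ s t) z) ∧
          0 < ε' ∧
          (∀ p : 𝕊³, height ((g.trans ψ.symm) p) = height p) ∧
          (∀ p : 𝕊³, zOneSq p < ε' → (g.trans ψ.symm) p = p) ∧
          (∀ p : 𝕊³, 0 < zOneSq p →
              0 < stdSymplecticForm (((g.trans ψ.symm) p : 𝕊³) : E4)
                (deriv (fun θ : ℝ => (((g.trans ψ.symm) (hopfTurn θ p) : 𝕊³) : E4)) 0)) := by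
  sorry

/-- **Stub LEVEL — a level-preserving, positively transverse diffeomorphism of `S³` that is the
identity near `K` is diffeotopic to the identity (L; GZ10 Lemma 5.3 without marked points).**
Hypotheses: `H ∘ m = H`; `m = id` on `𝒰^ε`; for `p ∉ K` the image of the standard circle through
`p` has `α₀`-positive velocity at `m p`.  Proof (GZ10 p. 12, two displayed formulas): on `S³ ∖ 𝒰^ε`
use the coordinates `(θ'', s, t) ↦ u^t_s(e^{iθ''}) = (√(1-s²-t²) e^{i(θ''+θ(s,t))}, s, t)` of GZ10
§2.3, in which the `s`-curves are the leaves of the characteristic foliation `S^t_ξ` (Legendrian,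
`α₀(∂_s) = 0`) and the `θ''`-curves are the standard circles; then `m = χ = (χ¹, χ², t)` (level
preservation), `χ = id` near the boundary `s² + t² = 1 - ε`, and positive transversality reads
`∂_θ χ¹ > 0` (`α₀|TS^t = a dθ''`, `a = ½|z₁|² > 0`).  Hence for each `(s, t)`, `θ ↦ χ¹(θ, s, t)` is a
circle diffeomorphism and `χ` maps `θ`-circles to graphs `s = s(θ)`, strictly ordered in `s`; stage 1
`(θ, s, t) ↦ (χ¹, (1-σ)χ² + σ s, t)`, `σ ∈ [0,1]`, is an isotopy through injective immersions
stationary near the boundary (Jacobian `(1-σ) det Dχ + σ ∂_θχ¹ > 0`; injective on each fibre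
`{χ¹ = Θ}` by the ordering of the graphs); stage 2 `((1-τ)χ̃¹ + τθ, s, t)` with `χ̃¹` the continuous
LIFT of `χ¹` normalised to `θ` on the collar where `m = id` — the collar `{1 - ε < s² + t² < 1 - ε/2}`
is CONNECTED (an annulus in the parameter disc), so the lift is `θ` on all of it and stage 2 is
stationary near the boundary as well (this replaces GZ10's marked-point normalisation
`χ(0, s, t) = (0, s, t)`; no `Γ₂`, no Smale theorem at any `πₖ` — the `π₁SO(3)`/Dehn-twist worry
of triage-1 cannot arise: a levelwise Dehn twist has lift `θ + 2πn` on one boundary circle of the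
annulus `A_t`, but both boundary circles of `A_t` lie in the same connected collar).  Extend by the
identity over `𝒰^ε`, concatenate, reparametrise to a `Diffeotopy` (stationary near `0` and `1`,
`Diffeotopy.reparam` / `Real.smoothTransition` as in `SmaleDiffDisc.lean`).  Why it might fail:
only as typed — smoothness of the assembled track near `∂𝒰^ε` needs the stationarity margins
chosen inside `{m = id}` (available: `m = id` on the OPEN set `𝒰^ε`); the coordinate change
`θ(s,t)` blows up only as `s → ±√(1-t²)`, i.e. inside `𝒰^ε`.  Size L (2-dimensional, explicit).
[cite: GeigesZehmisch2010, Lemma 5.3] -/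
theorem stub_levelTransverse :
    ∀ (m : 𝕊³ ≃ₘ⟮𝓡 3, 𝓡 3⟯ 𝕊³) (ε : ℝ), 0 < ε →
      (∀ p : 𝕊³, height (m p) = height p) →
      (∀ p : 𝕊³, zOneSq p < ε → m p = p) →
      (∀ p : 𝕊³, 0 < zOneSq p →
          0 < stdSymplecticForm ((m p : 𝕊³) : E4)
            (deriv (fun θ : ℝ => ((m (hopfTurn θ p) : 𝕊³) : E4)) 0)) →
        Diffeomorph.IsDiffeotopicToId m := by
  sorry

/-! ## Composition (kernel-checked; no `sorry` of its own) -/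

/-- **K2 = Geiges 2008 Prop 4.11.2 for POSITIVE contactomorphisms, from FIX-K + ENGINE + LEVEL.**
`φ ~ ψ` (FIX-K); ENGINE gives `g ∈ Ext` and the correction `m = ψ⁻¹ ∘ g`; LEVEL gives `m ~ id`,
so `m⁻¹ ∈ Ext` by Cerf's Lemma 2 (`ExtendsOverBall.of_isDiffeotopicToId`, radial sweep-out) and
`ψ = g ∘ m⁻¹ = m.symm.trans g ∈ Ext` (group law `ExtendsOverBall.trans`); finally `φ ∈ Ext` by
`ExtendsOverBall.of_isDiffeotopic` (GZ10 §2 ¶4 / Geiges §1.7.1: sweep the isotopy over a collar).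
The holomorphic certificate (b) is deliberately not consumed. [cite: GeigesZehmisch2010, §5 (proof of Γ₄ = 0)] -/
theorem contactomorphismsExtend (φ : 𝕊³ ≃ₘ⟮𝓡 3, 𝓡 3⟯ 𝕊³) (u : 𝕊³ → ℝ)
    (hφ : IsStdContacto φ u) : ExtendsOverBall 3 φ := by
  obtain ⟨ψ, u', ε, hψ, hψφ, hε, hfix⟩ := stub_fixUnknotNbhd φ u hφ
  obtain ⟨g, Γ, ε', hΓ, -, hε', hlev, hid, htr⟩ := stub_bishopFilling ψ u' ε hψ hε hfix
  have hm : Diffeomorph.IsDiffeotopicToId (g.trans ψ.symm) :=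
    stub_levelTransverse (g.trans ψ.symm) ε' hε' hlev hid htr
  have hg : ExtendsOverBall 3 g := ⟨Γ, hΓ⟩
  have key : ψ = (g.trans ψ.symm).symm.trans g := Diffeomorph.ext fun x => by
    obtain ⟨y, rfl⟩ : ∃ y, x = (g.trans ψ.symm) y := ⟨(g.trans ψ.symm).symm x, by simp⟩
    simp
  have hψext : ExtendsOverBall 3 ψ := by
    rw [key]
    exact (ExtendsOverBall.of_isDiffeotopicToId hm.symm).trans hg
  exact hψext.of_isDiffeotopic hψφ

/-- **K1 ∧ K2 ⟹ `Γ₄ = 0` in extension form** (every self-diffeomorphism of `S³` extends over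
`D⁴`).  Orientation-preserving `φ`: K1 gives a positive contactomorphism `g ~ φ`, `g ∈ Ext` by
`contactomorphismsExtend`, `φ ∈ Ext` by diffeotopy invariance.  Orientation-reversing `φ`: apply
this to `ρ ∘ φ`... precisely to `(sphereReflection v).trans φ`, and use that the hyperplane
reflection extends LINEARLY (`extendsOverBall_sphereReflection`; Disproof §4(i) honoured — no
orientation-naive isotopy claim).  Verbatim the proved glue `cerf_extends_of_contact` of
SketchIdeator1 with K1/K2 instantiated. [cite: Geiges2008, §1.7.1 and §4.11] -/
theorem cerf_extends : cerf_diffeomorph_sphere_three_extends_ball := by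
  intro φ
  obtain ⟨o, -⟩ := exists_smoothOrientation_sphere 3
  haveI : ConnectedSpace 𝕊³ := by
    refine isConnected_iff_connectedSpace.mp (isConnected_sphere ?_ 0 zero_le_one)
    rw [← Module.finrank_eq_rank, finrank_euclideanSpace_fin]
    norm_num
  have hpos : ∀ θ : 𝕊³ ≃ₘ⟮𝓡 3, 𝓡 3⟯ 𝕊³, θ.IsOrientationPreserving o o → ExtendsOverBall 3 θ := by
    intro θ hθ
    obtain ⟨g, u, hg, hu⟩ := stub_contactRepresentative o θ hθ
    exact (contactomorphismsExtend g u hu).of_isDiffeotopic hg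
  rcases Diffeomorph.isOrientationPreserving_or_isOrientationReversing_holds φ (by simp) o o
    with hφ | hφ
  · exact hpos φ hφ
  · set v : 𝕊³ := sphereBasePoint 3
    have hρ : IsOrientationPreserving o (-o) ⇑(sphereReflection v) :=
      sphereReflection_isOrientationReversing_of_ne_zero three_ne_zero v o
    have hφ' : IsOrientationPreserving (-o) o ⇑φ := by
      rw [← isOrientationPreserving_neg_neg_iff, neg_neg]
      exact hφ
    have hcomp : ((sphereReflection v).trans φ).IsOrientationPreserving o o := by
      show IsOrientationPreserving o o ⇑((sphereReflection v).trans φ)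
      rw [Diffeomorph.coe_trans]
      exact IsOrientationPreserving.comp_holds hφ' hρ (φ.mdifferentiable (by simp))
        ((sphereReflection v).mdifferentiable (by simp))
        (fun y => φ.det_mfderiv_ne_zero (by simp) y)
        (fun x => (sphereReflection v).det_mfderiv_ne_zero (by simp) x)
    have hext : ExtendsOverBall 3 ((sphereReflection v).trans φ) := hpos _ hcomp
    have key : φ = (sphereReflection v).symm.trans ((sphereReflection v).trans φ) :=
      Diffeomorph.ext fun x => by
        simp only [Diffeomorph.coe_trans, Function.comp_apply, Diffeomorph.apply_symm_apply]
    rw [key]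
    exact (extendsOverBall_sphereReflection v).symm.trans hext

/-- **The crux of route SchoenfliesSplit, BY NAME** (item stmt-SmoothPoincare4-8758; entry point
= Disproof §2 `schsplitCerf_of_extends`, i.e. the tree's PROVED chain
`cerf_twistedSphere_four_of_extends''`, which discharges the gluing and cover clauses of §3). -/
theorem SchsplitCerf_of :
    Summit.SmoothPoincare4.SmoothPoincare4.Theses.SchoenfliesSplit.SchsplitCerf :=
  cerf_twistedSphere_four_of_extends'' cerf_extends

/-- The same item under its SymplecticOrigami name (primary route of this unit). -/
theorem CerfGammaFour_of :
    Summit.SmoothPoincare4.SmoothPoincare4.Theses.SymplecticOrigami.CerfGammaFour :=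
  cerf_twistedSphere_four_of_extends'' cerf_extends

/-- The same item under its EuclideanOrigami name. -/
theorem EuclideanOrigami_SchsplitCerf_of :
    Summit.SmoothPoincare4.SmoothPoincare4.Theses.EuclideanOrigami.SchsplitCerf :=
  cerf_twistedSphere_four_of_extends'' cerf_extends

/-- The skeleton over the tree's named fact directly: only the four stubs stand between this file
and `cerf_twistedSphere_four`. -/
example : cerf_twistedSphere_four := cerf_twistedSphere_four_of_extends'' cerf_extends

/-! ## Sanity: non-vacuity and sign conventions (sorry-free) -/

/-- The hypotheses `IsStdContacto` of K1 (conclusion) / FIX-K / ENGINE are satisfiable: the identity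
with factor `e⁰`. -/
theorem isStdContacto_refl : IsStdContacto (Diffeomorph.refl (𝓡 3) 𝕊³ ∞) (fun _ => 0) :=
  ⟨contMDiff_const, fun z v => by simp only [Real.exp_zero, one_mul]; rfl⟩

/-- The infinitesimal generator `∂_θ = (i z₁, 0) = (-y₁, x₁, 0, 0)` of the circle action. -/
def turnGen (x : E4) : E4 := WithLp.toLp 2 ![-x 1, x 0, 0, 0]
/-- Auxiliary: the `z₁`-part of `x`. -/
def turnBase (x : E4) : E4 := WithLp.toLp 2 ![x 0, x 1, 0, 0]
/-- Auxiliary: the `z₂`-part of `x`. -/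
def turnRest (x : E4) : E4 := WithLp.toLp 2 ![0, 0, x 2, x 3]

/-- **Sign convention**: `ω₀(p, ∂_θ) = |z₁|²`, i.e. `α₀(∂_θ) = ½|z₁|² > 0` off `K` (GZ10 §2.4:
the standard circles are POSITIVELY transverse to `ξ`). -/
theorem stdSymplecticForm_turnGen (x : E4) :
    stdSymplecticForm x (turnGen x) = x 0 ^ 2 + x 1 ^ 2 := by
  simp [stdSymplecticForm, turnGen]; ring

theorem turnVec_eq (θ : ℝ) (x : E4) :
    turnVec θ x = Real.cos θ • turnBase x + Real.sin θ • turnGen x + turnRest x := by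
  ext i; fin_cases i <;> simp [turnVec, turnBase, turnGen, turnRest] <;> ring

theorem hasDerivAt_turnVec (x : E4) (θ : ℝ) :
    HasDerivAt (fun θ => turnVec θ x) (-Real.sin θ • turnBase x + Real.cos θ • turnGen x) θ := by
  have h := (((Real.hasDerivAt_cos θ).smul_const (turnBase x)).add
    ((Real.hasDerivAt_sin θ).smul_const (turnGen x))).add_const (turnRest x)
  refine (h.congr_of_eventuallyEq (Filter.Eventually.of_forall fun θ => ?_)).congr_deriv ?_
  · simp only [Pi.add_apply, turnVec_eq]
  · simp [neg_smul]

/-- The velocity of the standard circle through `x` at `θ = 0` is `∂_θ = turnGen x`. -/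
theorem deriv_turnVec_zero (x : E4) : deriv (fun θ => turnVec θ x) 0 = turnGen x := by
  rw [(hasDerivAt_turnVec x 0).deriv]
  simp

/-- **Non-vacuity of the three `m`-clauses** (conclusion (c) of ENGINE = hypotheses of LEVEL):
the identity satisfies them, the transversality clause becoming `|z₁|² > 0` off `K`. -/
theorem levelClauses_refl (ε : ℝ) :
    (∀ p : 𝕊³, height ((Diffeomorph.refl (𝓡 3) 𝕊³ ∞) p) = height p) ∧
    (∀ p : 𝕊³, zOneSq p < ε → (Diffeomorph.refl (𝓡 3) 𝕊³ ∞) p = p) ∧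
    (∀ p : 𝕊³, 0 < zOneSq p →
      0 < stdSymplecticForm (((Diffeomorph.refl (𝓡 3) 𝕊³ ∞) p : 𝕊³) : E4)
        (deriv (fun θ : ℝ => (((Diffeomorph.refl (𝓡 3) 𝕊³ ∞) (hopfTurn θ p) : 𝕊³) : E4)) 0)) := by
  refine ⟨fun p => rfl, fun p _ => rfl, fun p hp => ?_⟩
  have h : (fun θ : ℝ => (((Diffeomorph.refl (𝓡 3) 𝕊³ ∞) (hopfTurn θ p) : 𝕊³) : E4)) =
      fun θ => turnVec θ p := rfl
  rw [h, deriv_turnVec_zero]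
  show 0 < stdSymplecticForm (p : E4) (turnGen p)
  rw [stdSymplecticForm_turnGen]
  exact hp

/-- Basis vector `e₀ = (1, 0, 0, 0)`. -/
def eZero : E4 := WithLp.toLp 2 ![1, 0, 0, 0]
/-- Basis vector `e₁ = (0, 1, 0, 0)`. -/
def eOne : E4 := WithLp.toLp 2 ![0, 1, 0, 0]

/-- The linear part of the standard disc, `w ↦ √(1-s²-t²) (Re w, Im w, 0, 0)`. -/
def stdDiscLin (s t : ℝ) : ℂ →L[ℝ] E4 :=
  Real.sqrt (1 - s ^ 2 - t ^ 2) • (Complex.reCLM.smulRight eZero + Complex.imCLM.smulRight eOne)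

theorem stdDisc_eq (s t : ℝ) (z : ℂ) :
    stdDisc s t z = stdDiscLin s t z + WithLp.toLp 2 ![0, 0, s, t] := by
  ext i; fin_cases i <;> simp [stdDisc, stdDiscLin, eZero, eOne]

theorem hasFDerivAt_stdDisc (s t : ℝ) (z : ℂ) : HasFDerivAt (stdDisc s t) (stdDiscLin s t) z := by
  have h := ((stdDiscLin s t).hasFDerivAt (x := z)).add_const (WithLp.toLp 2 ![0, 0, s, t])
  refine h.congr_of_eventuallyEq (Filter.Eventually.of_forall fun w => ?_)
  simp only [stdDisc_eq]

/-- **Convention check for clause (b)**: the standard flat discs `D^t_s` are `J₀`-holomorphic in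
the sense `IsJHolAt` (`stdComplexStructure` is multiplication by `i` in the coordinates
`z₁ = x₀ + i x₁`, `z₂ = x₂ + i x₃` of `stdDisc`). So ENGINE holds at `ψ = id` with `Γ = id`. -/
theorem isJHolAt_stdDisc (s t : ℝ) (z : ℂ) : IsJHolAt (stdDisc s t) z := by
  refine ⟨(hasFDerivAt_stdDisc s t z).differentiableAt, fun w => ?_⟩
  rw [(hasFDerivAt_stdDisc s t z).fderiv]
  ext i
  fin_cases i <;> simp [stdDiscLin, eZero, eOne, stdComplexStructure, stdComplexStructureLin]

theorem norm_stdDisc_sq (s t : ℝ) (z : ℂ) (h : s ^ 2 + t ^ 2 < 1) :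
    ‖stdDisc s t z‖ ^ 2 = (1 - s ^ 2 - t ^ 2) * (z.re ^ 2 + z.im ^ 2) + s ^ 2 + t ^ 2 := by
  rw [EuclideanSpace.real_norm_sq_eq, Fin.sum_univ_four]
  simp only [stdDisc]
  have hs : Real.sqrt (1 - s ^ 2 - t ^ 2) ^ 2 = 1 - s ^ 2 - t ^ 2 := Real.sq_sqrt (by linarith)
  simp
  nlinarith [hs]

/-- For `s² + t² < 1` the standard disc maps the open unit disc into the OPEN ball. -/
theorem norm_stdDisc_lt_one {s t : ℝ} {z : ℂ} (h : s ^ 2 + t ^ 2 < 1)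
    (hz : z ∈ Metric.ball (0 : ℂ) 1) : ‖stdDisc s t z‖ < 1 := by
  have hz' : z.re ^ 2 + z.im ^ 2 < 1 := by
    rw [Metric.mem_ball, dist_zero_right] at hz
    have h1 : ‖z‖ ^ 2 < 1 := by nlinarith [norm_nonneg z]
    have h2 : ‖z‖ ^ 2 = z.re ^ 2 + z.im ^ 2 := by
      rw [Complex.sq_norm, Complex.normSq_apply]; ring
    linarith
  have key : ‖stdDisc s t z‖ ^ 2 < 1 := by
    rw [norm_stdDisc_sq s t z h]
    nlinarith
  nlinarith [norm_nonneg (stdDisc s t z)]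

/-- Near a point of the open disc, `discImage id` is the standard disc itself (the clamp is the
identity there). -/
theorem discImage_refl_eventuallyEq {s t : ℝ} (h : s ^ 2 + t ^ 2 < 1) {z : ℂ}
    (hz : z ∈ Metric.ball (0 : ℂ) 1) :
    discImage (Diffeomorph.refl (𝓡∂ (3 + 1)) 𝔻⁴ ∞) s t =ᶠ[𝓝 z] stdDisc s t := by
  filter_upwards [Metric.isOpen_ball.mem_nhds hz] with w hw
  simp only [discImage, Diffeomorph.coe_refl, id]
  exact closedBallRetraction_of_norm_le (3 + 1) (norm_stdDisc_lt_one h hw).le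

/-- **ENGINE holds at `ψ = id`, with `g = id`, `Γ = id`, `ε' = ε`** — a complete non-vacuity
certificate of the typed conclusion of `stub_bishopFilling` (clauses (a), (b), (c) all PROVED for
the standard holomorphic filling `F_st`; GZ10 §2: "Section 2 can be read as a description of the
structure of `𝒲_id`"). -/
theorem engine_at_refl (ε : ℝ) (hε : 0 < ε) :
    ∃ (g : 𝕊³ ≃ₘ⟮𝓡 3, 𝓡 3⟯ 𝕊³) (Γ : 𝔻⁴ ≃ₘ⟮𝓡∂ (3 + 1), 𝓡∂ (3 + 1)⟯ 𝔻⁴) (ε' : ℝ),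
      (∀ z : 𝕊³, Γ (Set.inclusion Metric.sphere_subset_closedBall z) =
          Set.inclusion Metric.sphere_subset_closedBall (g z)) ∧
      (∀ s t : ℝ, s ^ 2 + t ^ 2 < 1 → ∀ z ∈ Metric.ball (0 : ℂ) 1,
          IsJHolAt (discImage Γ s t) z) ∧
      0 < ε' ∧
      (∀ p : 𝕊³, height ((g.trans (Diffeomorph.refl (𝓡 3) 𝕊³ ∞).symm) p) = height p) ∧
      (∀ p : 𝕊³, zOneSq p < ε' → (g.trans (Diffeomorph.refl (𝓡 3) 𝕊³ ∞).symm) p = p) ∧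
      (∀ p : 𝕊³, 0 < zOneSq p →
          0 < stdSymplecticForm (((g.trans (Diffeomorph.refl (𝓡 3) 𝕊³ ∞).symm) p : 𝕊³) : E4)
            (deriv (fun θ : ℝ =>
              (((g.trans (Diffeomorph.refl (𝓡 3) 𝕊³ ∞).symm) (hopfTurn θ p) : 𝕊³) : E4)) 0)) := by
  refine ⟨Diffeomorph.refl (𝓡 3) 𝕊³ ∞, Diffeomorph.refl (𝓡∂ (3 + 1)) 𝔻⁴ ∞, ε, fun z => rfl,
    fun s t hst z hz => ?_, hε, fun p => rfl, fun p _ => rfl, fun p hp => ?_⟩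
  · have hev := discImage_refl_eventuallyEq hst hz
    obtain ⟨hd, hcr⟩ := isJHolAt_stdDisc s t z
    refine ⟨hd.congr_of_eventuallyEq hev, fun w => ?_⟩
    rw [hev.fderiv_eq]
    exact hcr w
  · have h : (fun θ : ℝ => ((((Diffeomorph.refl (𝓡 3) 𝕊³ ∞).trans
        (Diffeomorph.refl (𝓡 3) 𝕊³ ∞).symm) (hopfTurn θ p) : 𝕊³) : E4)) =
        fun θ => turnVec θ p := rfl
    rw [h, deriv_turnVec_zero]
    show 0 < stdSymplecticForm (p : E4) (turnGen p)
    rw [stdSymplecticForm_turnGen]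
    exact hp

/-- The stub `stub_bishopFilling` specialised to `ψ = id` is therefore a THEOREM of this file. -/
example (ε : ℝ) (hε : 0 < ε)
    (_h : ∀ p : 𝕊³, zOneSq p < ε → (Diffeomorph.refl (𝓡 3) 𝕊³ ∞) p = p) :=
  engine_at_refl ε hε

end Summit.SmoothPoincare4.SmoothPoincare4.Cruxes.SchsplitCerf.EliashbergLeviFlatDiscs

end
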